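import Summits.Langlands.Langlands.Theses.PhantomRMYoshida
import HarnessLib

/-!
# Route `PhantomRMYoshida`, crux `ResiduallyYoshidaLifting` (stmt-Langlands-13639): typed currency of the
# line `cross-regular-annihilator-primes` (route-posited objects, D-0016 `<Route>Defs`-type file)

DEFINITIONS ONLY (no theorem, no sorry; nothing is asserted — every `def … : Prop` below is a *statement*
consumed only as part of the type of a registered stub or of the crux).  This is the planner's currency module
`Cruxes/ResiduallyYoshidaLifting/CrossRegularCurrency.lean` (planner-cruxplan-…-cross-regular-annihi-0,
2026-08-16T00:16Z; the definition item it filed for "a Literature/Theorems home"), byte-identical in its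
definientia, re-homed under `Theorems/` so that landed stub files may import it, and declared in the namespace of
the lead's registered skeleton `Summit.Langlands.Langlands.Cruxes.ResiduallyYoshidaLifting.CrossRegularAnnihilatorPrimes`
(NOT the workfile namespace `…CrossRegular`, to keep fully-qualified names distinct from the crux-directory copy),
so that a landed `theorem stub_<name> : <registered signature>` reads byte-identically to its registration.

Objects. `epsBar`, `DetCond`, `Sh`, `Aut` are VERBATIM the crux's inline `let εb`, determinant clause, `let Sh`,
`let Aut` (definitionally equal: the skeleton passes the crux's hypotheses to the stubs by `rfl` unfolding);
`Gen`, `CrossRes`, `CrossCongr`, `CrossType`, `Member`, `HSC`, `ExactCross`, `QGood`, `QGoodRes`, `CrossFamily`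
are the line's interface notions: residual genericity of a ×-configuration, cross-regular residual Frobenius,
×-congruence mod `p^N`, ×-type (square-zero monodromy, exact Frobenius shape), member of a Hecke family of level
`K(𝔫)` and infinity type `T`, Hecke-span congruence mod `p^N`, exact cross-regular element, admissible auxiliary
place of depth `N`, residually admissible place, ×-type family.  See the docstrings; sources as cited there.

Conventions: `𝒪 = Valued.integer (PadicAlgCl p) = ℤ̄_p`; `q_v = v.residueCard`; arithmetic Frobenius; `ρ`
symplectic with multiplier `ε⁻¹` (cohomological convention of the route), so at an unramified `v` the eigenvalues
pair as `x ↔ q_v⁻¹ x⁻¹` and the ×-shape is `{a, q_v a, b, q_v b}` with `q_v² a b = 1` (`a ↔ q_v b`, `q_v a ↔ b`).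

What is NOT here: any theorem beyond the definitional `stub_cruxUnfold` (`Iff.rfl`: the crux reads literally over
`DetCond/Sh/Aut`; a registered sub-goal of the crux item) — the stubs live in the lead's skeleton `Cruxes/…/Lines/cross-regular-annihilator-primes.lean`
and land one file each as `Theorems/PhantomRMYoshidaResiduallyYoshidaLifting<Stub>.lean`).

References: J. Thorne, *Automorphy of some residually dihedral Galois representations*, Math. Ann. 364 (2016)
[Thorne2016, §5.4.4, Prop. 5.20, Lemma 5.23, Thm. 4.14, Cor. 4.15]; G. Boxer, F. Calegari, T. Gee, V. Pilloni
[BoxerEtAl2021, §2, §7.3]; K. Buzzard, T. Gee [BuzzardGeeLMS2014, Conj. 3.2.1]; A. Borel, H. Jacquet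
[BorelJacquet1979, 4.6]; C. Sorensen [Sorensen2006, Thm. A].
-/

noncomputable section

-- `Summit.Langlands.Langlands.…` (summit = sub-problem name, D-0017 layout) trips `dupNamespace` on every decl.
set_option linter.dupNamespace false

open scoped Matrix Classical
open Filter

-- `open scoped Classical` is REQUIRED to elaborate `π.1.W` (the place subtypes indexing `mixedSpace ℚ` are
-- `Fintype` classically; cf. `AutomorphicRepsGL`, `UnitaryGroupAutomorphicRep` (H5)).

namespace Summit.Langlands.Langlands.Cruxes.ResiduallyYoshidaLifting.CrossRegularAnnihilatorPrimes

variable {p : ℕ} [Fact p.Prime] {k : Type} [Field k] [TopologicalSpace k]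

/-- The route's inline mod-`p` cyclotomic character `ε̄ : Γ_ℚ → (ℤ/p)ˣ` (verbatim the crux's `let εb`;
Mathlib `modularCyclotomicCharacter` on `Γ_ℚ`). [folklore] -/
def epsBar (p : ℕ) [Fact p.Prime] : Field.absoluteGaloisGroup ℚ →* (ZMod p)ˣ :=
  (modularCyclotomicCharacter (AlgebraicClosure ℚ)
    (HasEnoughRootsOfUnity.natCard_rootsOfUnity (AlgebraicClosure ℚ) p)).comp
    (MulSemiringAction.toRingAut (Field.absoluteGaloisGroup ℚ) (AlgebraicClosure ℚ))

/-- The crux's determinant clause `det σ̄ = ε̄⁻¹ = det σ̄'` (verbatim). [folklore] -/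
def DetCond (p : ℕ) [Fact p.Prime] {k : Type} [Field k] [CharP k p] [TopologicalSpace k] [DiscreteTopology k]
    (σ σ' : Literature.NumberTheory.GaloisRepresentations.FramedGaloisRep ℚ k 2) : Prop :=
  ∀ g, Literature.NumberTheory.GaloisRepresentations.FramedRep.det σ g = (Units.map (ZMod.castHom (dvd_refl p) k).toMonoidHom (epsBar p g))⁻¹ ∧
    Literature.NumberTheory.GaloisRepresentations.FramedRep.det σ' g = Literature.NumberTheory.GaloisRepresentations.FramedRep.det σ g

/-- The crux's shape clause `Sh r` (verbatim the route's `let Sh`): `r` symplectic with multiplier `ε⁻¹`,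
Greenberg-ordinary of Hodge–Tate shape `(0,0,1,1)` and residually distinguished at `p`, and residually
`σ̄ ⊕ σ̄'` through `red` on almost all Frobenius polynomials. [cite: BoxerEtAl2021, §2 and §7.3 (conventions)] -/
def Sh (σ σ' : Literature.NumberTheory.GaloisRepresentations.FramedGaloisRep ℚ k 2) (red : Valued.integer (PadicAlgCl p) →+* k) (r : Literature.NumberTheory.GaloisRepresentations.FramedGaloisRep ℚ (PadicAlgCl p) 4) : Prop :=
  r.IsSymplecticWithMultiplierFun (fun g => algebraMap ℚ_[p] (PadicAlgCl p)
    ((((Literature.NumberTheory.GaloisRepresentations.GaloisRep.cyclotomicCharacter ℚ p g)⁻¹ : ℤ_[p]ˣ) : ℤ_[p]) : ℚ_[p])) ∧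
  (∀ v : IsDedekindDomain.HeightOneSpectrum (NumberField.RingOfIntegers ℚ), ((p : ℕ) : NumberField.RingOfIntegers ℚ) ∈ v.asIdeal →
    r.IsGreenbergOrdinaryOfShapeAt v ![0, 0, 1, 1] ∧ r.IsResiduallyDistinguishedAt v ![0, 0, 1, 1]) ∧
  (∀ᶠ v : IsDedekindDomain.HeightOneSpectrum (NumberField.RingOfIntegers ℚ) in Filter.cofinite, r.IsUnramifiedAt v ∧ σ.IsUnramifiedAt v ∧ σ'.IsUnramifiedAt v ∧
    ∃ (P : Polynomial (Valued.integer (PadicAlgCl p))) (P₁ P₂ : Polynomial k),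
      r.HasFrobCharpolyAt v (P.map (Valued.integer (PadicAlgCl p)).subtype) ∧
      σ.HasFrobCharpolyAt v P₁ ∧ σ'.HasFrobCharpolyAt v P₂ ∧ P.map red = P₁ * P₂)

/-- The crux's automorphy clause `Aut r` (verbatim the route's `let Aut`): an L-algebraic cuspidal `π` on
`GL₄(𝔸_ℚ)` whose Satake parameters give the arithmetic-Frobenius polynomials of `r` at almost all places.
[cite: BuzzardGeeLMS2014, Conj. 3.2.1 (normalisation)] -/
def Aut (hcpt : Literature.NumberTheory.Automorphic.isCompact_glFiniteIntegralLevel 4 ℚ) (ι : PadicAlgCl p ≃+* ℂ)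
    (r : Literature.NumberTheory.GaloisRepresentations.FramedGaloisRep ℚ (PadicAlgCl p) 4) : Prop :=
  ∃ π : Literature.NumberTheory.Automorphic.CuspidalAutomorphicRepData 4 ℚ hcpt, π.1.IsLAlgebraic ∧ ∀ᶠ v : IsDedekindDomain.HeightOneSpectrum (NumberField.RingOfIntegers ℚ) in Filter.cofinite, ∃ a : Multiset ℂ,
    π.1.HasSatakeParamAt v a ∧ r.IsUnramifiedAt v ∧
      r.HasFrobCharpolyAt v (Literature.NumberTheory.Automorphic.arithFrobPolyOfSatake ι v.residueCard 1 a)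

/-- Residual GENERICITY of a ×-configuration `{a, q a | b, q b}` in `k`: the four eigenvalues are pairwise
distinct and neither residual constituent has an internal ratio `q^{±1}` (`a ≠ q²b`, `b ≠ q²a`); the only
ratio-`q` pairs are the two cross pairs `(a, qa)`, `(b, qb)` (`q² = 1`, i.e. `q ≡ −1`, is allowed: triage
r1-2 sharpen (i)). [cite: Thorne2016, §5.4.4 (two distinct eigenvalues α_v, β_v with α_v/β_v = q_v)] -/
def Gen (q a b : k) : Prop :=
  a ≠ q * a ∧ a ≠ b ∧ a ≠ q * b ∧ q * a ≠ b ∧ q * a ≠ q * b ∧ b ≠ q * b ∧ a ≠ q ^ 2 * b ∧ b ≠ q ^ 2 * a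

/-- CROSS-REGULAR residual Frobenius at `v` in the fixed cross position: `σ̄(Frob_v)` has eigenvalues
`{a, q̄_v b}`, `σ̄'(Frob_v)` has `{q̄_v a, b}`, generic (`Gen`). [cite: Thorne2016, Lemma 5.18 (regularity of ρ̄(Frob_v) is what lets the Steinberg-type condition see the invisible summand)] -/
def CrossRes (σ σ' : Literature.NumberTheory.GaloisRepresentations.FramedGaloisRep ℚ k 2) (v : IsDedekindDomain.HeightOneSpectrum (NumberField.RingOfIntegers ℚ)) (a b : k) : Prop :=
  σ.HasFrobCharpolyAt v ((Polynomial.X - Polynomial.C a) * (Polynomial.X - Polynomial.C ((v.residueCard : k) * b))) ∧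
  σ'.HasFrobCharpolyAt v ((Polynomial.X - Polynomial.C ((v.residueCard : k) * a)) * (Polynomial.X - Polynomial.C b)) ∧
  Gen (v.residueCard : k) a b

/-- ×-CONGRUENCE mod `p^N` of `r(Frob_v)`: its (integral) Frobenius polynomial is congruent coefficientwise
modulo `p^N` in `ℤ̄_p` to `(X−a)(X−q_v a)(X−b)(X−q_v b)` with `q_v² a b = 1` EXACTLY — `r mod p^N` is an
unramified point of the ×-type local deformation problem at `v`. [cite: Thorne2016, Prop. 5.20 ("ρ(Frob_v) agrees modulo p^N with ρ(c)")] -/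
def CrossCongr (N : ℕ) (v : IsDedekindDomain.HeightOneSpectrum (NumberField.RingOfIntegers ℚ)) (r : Literature.NumberTheory.GaloisRepresentations.FramedGaloisRep ℚ (PadicAlgCl p) 4) (a b : Valued.integer (PadicAlgCl p)) : Prop :=
  ∃ P : Polynomial (Valued.integer (PadicAlgCl p)), r.HasFrobCharpolyAt v (P.map (Valued.integer (PadicAlgCl p)).subtype) ∧
    (v.residueCard : Valued.integer (PadicAlgCl p)) ^ 2 * a * b = 1 ∧
    ∀ j : ℕ, ((p : Valued.integer (PadicAlgCl p))) ^ N ∣ (P - (Polynomial.X - Polynomial.C a) * (Polynomial.X - Polynomial.C ((v.residueCard : Valued.integer (PadicAlgCl p)) * a)) *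
      (Polynomial.X - Polynomial.C b) * (Polynomial.X - Polynomial.C ((v.residueCard : Valued.integer (PadicAlgCl p)) * b))).coeff j

/-- ×-TYPE at `v` of a characteristic-0 representation `r` (the local type of a Klingen-new, Roberts–Schmidt
IIIa-type point): inertia at `v` acts unipotently with square-zero monodromy, `(r(τ) − 1)² = 0`, and every
arithmetic Frobenius has characteristic polynomial EXACTLY `(X−a)(X−q_v a)(X−b)(X−q_v b)` with `q_v² a b = 1`
(two mutually paired Lagrangian Jordan blocks). [cite: Thorne2016, §5.4.4 (D_v^St(α_v))] -/
def CrossType (v : IsDedekindDomain.HeightOneSpectrum (NumberField.RingOfIntegers ℚ)) (r : Literature.NumberTheory.GaloisRepresentations.FramedGaloisRep ℚ (PadicAlgCl p) 4) : Prop :=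
  (∀ 𝔓 ∈ v.primesAbove, ∀ τ ∈ 𝔓.inertia (Field.absoluteGaloisGroup ℚ), ((r τ).val - 1) * ((r τ).val - 1) = 0) ∧
  ∃ a b : PadicAlgCl p, (v.residueCard : PadicAlgCl p) ^ 2 * a * b = 1 ∧
    r.HasFrobCharpolyAt v ((Polynomial.X - Polynomial.C a) * (Polynomial.X - Polynomial.C ((v.residueCard : PadicAlgCl p) * a)) * (Polynomial.X - Polynomial.C b) *
      (Polynomial.X - Polynomial.C ((v.residueCard : PadicAlgCl p) * b)))

/-- MEMBER of a Hecke family of level `𝔫` and infinity type `T`: a cuspidal L-algebraic `π` on `GL₄(𝔸_ℚ)`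
with a non-zero `K(𝔫)`-fixed form (principal congruence level, `principalCongruenceLevel`) and infinity type
`T`, together with a Galois representation `r`, irreducible, of the crux's shape `Sh` (same residual pair
`σ̄ ⊕ σ̄'`, ordinary `(0,0,1,1)`), matching `π` at almost all places. [cite: BorelJacquet1979, 4.6 (automorphic representations, level)] -/
def Member (σ σ' : Literature.NumberTheory.GaloisRepresentations.FramedGaloisRep ℚ k 2) (red : Valued.integer (PadicAlgCl p) →+* k)
    {hcpt : Literature.NumberTheory.Automorphic.isCompact_glFiniteIntegralLevel 4 ℚ} (ι : PadicAlgCl p ≃+* ℂ)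
    (𝔫 : Ideal (NumberField.RingOfIntegers ℚ)) (T : Literature.NumberTheory.Automorphic.InfinityType ℚ 4) (π : Literature.NumberTheory.Automorphic.CuspidalAutomorphicRepData 4 ℚ hcpt) (r : Literature.NumberTheory.GaloisRepresentations.FramedGaloisRep ℚ (PadicAlgCl p) 4) : Prop :=
  π.1.IsLAlgebraic ∧ π.1.HasInfinityType T ∧
  (∃ φ ∈ π.1.W, φ ∉ π.1.W' ∧ ∀ u ∈ Literature.NumberTheory.Automorphic.principalCongruenceLevel 4 ℚ 𝔫,
    Literature.NumberTheory.Automorphic.rightTranslation (Literature.NumberTheory.Automorphic.AdelicGroupData.gl 4 ℚ) u φ = φ) ∧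
  r.toGaloisRep.IsIrreducible ∧ Sh σ σ' red r ∧
  (∀ᶠ v : IsDedekindDomain.HeightOneSpectrum (NumberField.RingOfIntegers ℚ) in Filter.cofinite, ∃ a : Multiset ℂ, π.1.HasSatakeParamAt v a ∧ r.IsUnramifiedAt v ∧
    r.HasFrobCharpolyAt v (Literature.NumberTheory.Automorphic.arithFrobPolyOfSatake ι v.residueCard 1 a))

/-- HECKE-SPAN CONGRUENCE mod `p^N` ("`ϱ mod p^N` is an `𝒪/p^N`-point of the anaemic Hecke algebra of the
family `ρf`"): away from a finite set `S`, the `ρf i` and `ϱ` are unramified with integral Frobenius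
polynomials `Pf i v`, `Pr v ∈ ℤ̄_p[X]`, and EVERY `ℤ̄_p`-polynomial relation among the coefficients
`(Pf i v)_j` (in the variables `(v, j)`, `v ∉ S`) that holds for all `i` holds for the `(Pr v)_j` modulo `p^N`.
Equivalently: `T := ℤ̄_p[(coeff tuples)] ⊆ ∏_i ℤ̄_p` admits a ring map `T → ℤ̄_p/p^N` sending each generator to
the corresponding coefficient of `ϱ`. [cite: Thorne2016, Cor. 4.15 (f(T_v) = tr ρ(Frob_v) mod λ^N)] -/
def HSC (N : ℕ) (r : ℕ) (ρf : Fin r → Literature.NumberTheory.GaloisRepresentations.FramedGaloisRep ℚ (PadicAlgCl p) 4) (ϱ : Literature.NumberTheory.GaloisRepresentations.FramedGaloisRep ℚ (PadicAlgCl p) 4) : Prop :=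
  ∃ S : Set (IsDedekindDomain.HeightOneSpectrum (NumberField.RingOfIntegers ℚ)), S.Finite ∧ ∃ (Pf : Fin r → IsDedekindDomain.HeightOneSpectrum (NumberField.RingOfIntegers ℚ) → Polynomial (Valued.integer (PadicAlgCl p))) (Pr : IsDedekindDomain.HeightOneSpectrum (NumberField.RingOfIntegers ℚ) → Polynomial (Valued.integer (PadicAlgCl p))),
    (∀ i, ∀ v ∉ S, (ρf i).IsUnramifiedAt v ∧ (ρf i).HasFrobCharpolyAt v ((Pf i v).map (Valued.integer (PadicAlgCl p)).subtype)) ∧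
    (∀ v ∉ S, ϱ.IsUnramifiedAt v ∧ ϱ.HasFrobCharpolyAt v ((Pr v).map (Valued.integer (PadicAlgCl p)).subtype)) ∧
    ∀ F : MvPolynomial ((IsDedekindDomain.HeightOneSpectrum (NumberField.RingOfIntegers ℚ)) × ℕ) (Valued.integer (PadicAlgCl p)), (∀ m ∈ F.support, ∀ x ∈ m.support, x.1 ∉ S) →
      (∀ i, MvPolynomial.eval (fun x => (Pf i x.1).coeff x.2) F = 0) →
        ((p : Valued.integer (PadicAlgCl p))) ^ N ∣ MvPolynomial.eval (fun x => (Pr x.1).coeff x.2) F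

/-- EXACT CROSS-REGULAR ELEMENT of `im ρ` (the line's coverage hypothesis): some `γ ∈ Γ_ℚ` with
`charpoly ρ(γ) = (X−a)(X−ea)(X−b)(X−eb)`, `e = ε_p(γ)`, `e²ab = 1` in `ℤ̄_p`, in cross position residually
(`σ̄(γ) ∼ {ā, ē b̄}`, `σ̄'(γ) ∼ {ē ā, b̄}`) and residually generic. [cite: Thorne2016, Prop. 5.20 (σ_× replaces complex conjugation c)] -/
def ExactCross (σ σ' : Literature.NumberTheory.GaloisRepresentations.FramedGaloisRep ℚ k 2) (red : Valued.integer (PadicAlgCl p) →+* k) (ρ : Literature.NumberTheory.GaloisRepresentations.FramedGaloisRep ℚ (PadicAlgCl p) 4) : Prop :=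
  ∃ (γ : Field.absoluteGaloisGroup ℚ) (a b e : Valued.integer (PadicAlgCl p)),
    (e : PadicAlgCl p) = algebraMap ℚ_[p] (PadicAlgCl p)
      (((Literature.NumberTheory.GaloisRepresentations.GaloisRep.cyclotomicCharacter ℚ p γ : ℤ_[p]ˣ) : ℤ_[p]) : ℚ_[p]) ∧
    e ^ 2 * a * b = 1 ∧
    (ρ γ).val.charpoly = (Polynomial.X - Polynomial.C (a : PadicAlgCl p)) * (Polynomial.X - Polynomial.C ((e : PadicAlgCl p) * (a : PadicAlgCl p))) *
      (Polynomial.X - Polynomial.C (b : PadicAlgCl p)) * (Polynomial.X - Polynomial.C ((e : PadicAlgCl p) * (b : PadicAlgCl p))) ∧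
    (σ γ).val.charpoly = (Polynomial.X - Polynomial.C (red a)) * (Polynomial.X - Polynomial.C (red e * red b)) ∧
    (σ' γ).val.charpoly = (Polynomial.X - Polynomial.C (red e * red a)) * (Polynomial.X - Polynomial.C (red b)) ∧
    Gen (red e) (red a) (red b)

/-- ADMISSIBLE AUXILIARY PLACE of depth `N` for `ρ` relative to the level `𝔫`: `v ∤ p𝔫`; `ρ`, `σ̄`, `σ̄'`
unramified at `v`; `ρ(Frob_v)` ×-congruent mod `p^N` (`CrossCongr`) with residually cross-regular generic
reduction in the fixed cross position (`CrossRes`). [cite: Thorne2016, Prop. 5.20 and Lemma 5.23] -/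
def QGood (σ σ' : Literature.NumberTheory.GaloisRepresentations.FramedGaloisRep ℚ k 2) (red : Valued.integer (PadicAlgCl p) →+* k) (𝔫 : Ideal (NumberField.RingOfIntegers ℚ))
    (ρ : Literature.NumberTheory.GaloisRepresentations.FramedGaloisRep ℚ (PadicAlgCl p) 4) (N : ℕ) (v : IsDedekindDomain.HeightOneSpectrum (NumberField.RingOfIntegers ℚ)) : Prop :=
  ¬ (v.asIdeal ∣ 𝔫) ∧ ((p : ℕ) : NumberField.RingOfIntegers ℚ) ∉ v.asIdeal ∧ ρ.IsUnramifiedAt v ∧ σ.IsUnramifiedAt v ∧ σ'.IsUnramifiedAt v ∧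
    ∃ a b : Valued.integer (PadicAlgCl p), CrossCongr N v ρ a b ∧ CrossRes σ σ' v (red a) (red b)

/-- RESIDUALLY ADMISSIBLE PLACE for the seed relative to `𝔫₀` and `ρ₀`: `v ∤ p𝔫₀`; `ρ₀`, `σ̄`, `σ̄'` unramified
at `v`; `σ̄ ⊕ σ̄'` cross-regular generic at `v` (`CrossRes`) — the residual level-raising position.
[cite: Sorensen2006, Thm. A (level-raising congruence for GSp₄)] -/
def QGoodRes (σ σ' : Literature.NumberTheory.GaloisRepresentations.FramedGaloisRep ℚ k 2) (𝔫₀ : Ideal (NumberField.RingOfIntegers ℚ)) (ρ₀ : Literature.NumberTheory.GaloisRepresentations.FramedGaloisRep ℚ (PadicAlgCl p) 4) (v : IsDedekindDomain.HeightOneSpectrum (NumberField.RingOfIntegers ℚ)) : Prop :=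
  ¬ (v.asIdeal ∣ 𝔫₀) ∧ ((p : ℕ) : NumberField.RingOfIntegers ℚ) ∉ v.asIdeal ∧ ρ₀.IsUnramifiedAt v ∧ σ.IsUnramifiedAt v ∧ σ'.IsUnramifiedAt v ∧
    ∃ a b : k, CrossRes σ σ' v a b

/-- ×-TYPE HECKE FAMILY of level `𝔫·∏_Q v²` and infinity type `T` at the auxiliary set `Q`, to which `ρ` is
Hecke-span congruent mod `p^N`: finitely many members (`Member`), each of ×-type at every `v ∈ Q`
(`CrossType`), and `HSC N`. [cite: Thorne2016, Thm. 4.14 (the datum (Q, f : T_Q → O/λ^N))] -/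
def CrossFamily (σ σ' : Literature.NumberTheory.GaloisRepresentations.FramedGaloisRep ℚ k 2) (red : Valued.integer (PadicAlgCl p) →+* k)
    (hcpt : Literature.NumberTheory.Automorphic.isCompact_glFiniteIntegralLevel 4 ℚ) (ι : PadicAlgCl p ≃+* ℂ)
    (𝔫 : Ideal (NumberField.RingOfIntegers ℚ)) (T : Literature.NumberTheory.Automorphic.InfinityType ℚ 4) (Q : Finset (IsDedekindDomain.HeightOneSpectrum (NumberField.RingOfIntegers ℚ))) (N : ℕ) (ρ : Literature.NumberTheory.GaloisRepresentations.FramedGaloisRep ℚ (PadicAlgCl p) 4) : Prop :=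
  ∃ (r : ℕ) (πf : Fin r → Literature.NumberTheory.Automorphic.CuspidalAutomorphicRepData 4 ℚ hcpt) (ρf : Fin r → Literature.NumberTheory.GaloisRepresentations.FramedGaloisRep ℚ (PadicAlgCl p) 4),
    (∀ i, Member σ σ' red ι (𝔫 * Q.prod (fun v => v.asIdeal ^ 2)) T (πf i) (ρf i) ∧ ∀ v ∈ Q, CrossType v (ρf i)) ∧
    HSC N r ρf ρ

/-- STUB S0 (definitional; the currency is VERBATIM the crux): over the Theorems-side currency
(`DetCond`, `Sh`, `Aut` of `…CrossRegularAnnihilatorPrimes`) the crux `ResiduallyYoshidaLifting` reads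
literally as below — `Iff.rfl`.  Registered so that the definitions-only currency module
`Theorems/PhantomRMYoshidaResiduallyYoshidaLiftingCrossRegularDefs.lean` lands `--supports` this crux and every
stub file imports ONE vocabulary. [cite: Thorne2016, §1 (architecture)] -/
theorem stub_cruxUnfold :
    (Summit.Langlands.Langlands.Theses.PhantomRMYoshida.ResiduallyYoshidaLifting ↔ ∀ (p : ℕ) [Fact p.Prime], p ≠ 2 → ∀ (k : Type) [Field k] [CharP k p] [IsAlgClosed k] [TopologicalSpace k] [DiscreteTopology k] (red : Valued.integer (PadicAlgCl p) →+* k) (σ σ' : Literature.NumberTheory.GaloisRepresentations.FramedGaloisRep ℚ k 2) (hcpt : Literature.NumberTheory.Automorphic.isCompact_glFiniteIntegralLevel 4 ℚ) (ι : PadicAlgCl p ≃+* ℂ) (ρ₀ ρ : Literature.NumberTheory.GaloisRepresentations.FramedGaloisRep ℚ (PadicAlgCl p) 4), σ.IsOdd → σ'.IsOdd → σ.toGaloisRep.IsIrreducible → σ'.toGaloisRep.IsIrreducible → Summit.Langlands.Langlands.Cruxes.ResiduallyYoshidaLifting.CrossRegularAnnihilatorPrimes.DetCond p σ σ' → (¬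 ∃ g : GL (Fin 2) k, ∀ x, g * σ x * g⁻¹ = σ' x) → ρ₀.toGaloisRep.IsIrreducible → Summit.Langlands.Langlands.Cruxes.ResiduallyYoshidaLifting.CrossRegularAnnihilatorPrimes.Sh σ σ' red ρ₀ → Summit.Langlands.Langlands.Cruxes.ResiduallyYoshidaLifting.CrossRegularAnnihilatorPrimes.Aut hcpt ι ρ₀ → ρ.toGaloisRep.IsIrreducible → Summit.Langlands.Langlands.Cruxes.ResiduallyYoshidaLifting.CrossRegularAnnihilatorPrimes.Sh σ σ' red ρ → Summit.Langlands.Langlands.Cruxes.ResiduallyYoshidaLifting.CrossRegularAnnihilatorPrimes.Aut hcpt ι ρ) :=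
  Iff.rfl

end Summit.Langlands.Langlands.Cruxes.ResiduallyYoshidaLifting.CrossRegularAnnihilatorPrimes

end
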